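import Literature.Computability.AlgebraicComplexity.BurgisserBooleanPartsA3Assembly
import Literature.NumberTheory.Sieve.BombieriAsymptoticSieveSigma0Comb

/-!
# LangWeilTransfer, support item `TransferGlue` (stmt-ValiantsHypothesis-6379) — prime picking

Route `LangWeilTransfer` of `ValiantsHypothesis`, support item `TransferGlue`. The glue discards a
set of "bad" primes of size up to `2^{poly}` (GoodReduction's exceptional set, the prime divisors of
the leading coefficient `cQ` and of a coefficient of `ρ`) and needs a good prime above a threshold
`X₀` (`2^T` and the Lang–Weil threshold) of controlled bit-size. Bertrand's postulate alone only
yields `log₂ p ≤ T + #bad + 1`, which is exponential in the number of unknowns; the Chebyshev bound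
`π(2^μ) ≥ 2^{μ-1}/μ` (tree `primeCounting_two_pow_ge`, from Mathlib `Chebyshev.pi_ge`) gives
`log₂ p ≤ 2 log₂(X₀ + #bad + 2) + 6` (`exists_prime_gt_notMem_le`); the count of prime divisors
`#primeFactors m ≤ log₂ m` is the tree's `BombieriSieve.card_primeFactors_le_log`. Honest framing: bookkeeping inside a dormant
route whose cruxes are open; nothing here bears on VP ≠ VNP.
-/

-- the summit and the problem share the name `ValiantsHypothesis` (D-0017 single-conjunct layout)
set_option linter.dupNamespace false

namespace Summit.ValiantsHypothesis.ValiantsHypothesis.Theorems.LangWeilTransfer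

open Literature.Computability.AlgebraicComplexity (primeCounting_two_pow_ge)

-- `#primeFactors m ≤ log₂ m` is the tree's
-- `Literature.NumberTheory.Sieve.BombieriSieve.card_primeFactors_le_log` (imported above).

/-- `π(2^μ) · μ ≥ 2^{μ-1}` for `μ ≥ 3`, natural-number form of the tree's Chebyshev bound. -/
theorem two_pow_le_mul_primeCounting {μ : ℕ} (hμ : 3 ≤ μ) :
    2 ^ (μ - 1) ≤ μ * Nat.primeCounting (2 ^ μ) := by
  have h := primeCounting_two_pow_ge hμ
  have hμpos : (0 : ℝ) < μ := by exact_mod_cast (show 0 < μ by omega)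
  rw [div_le_iff₀ hμpos] at h
  have : ((2 ^ (μ - 1) : ℕ) : ℝ) ≤ ((μ * Nat.primeCounting (2 ^ μ) : ℕ) : ℝ) := by
    push_cast
    linarith
  exact_mod_cast this

/-- `(ℓ + 3) · 2^{ℓ+2} ≤ 2^{2ℓ+5}`. -/
theorem aux_pow_bound (ℓ : ℕ) : (2 * ℓ + 6) * 2 ^ (ℓ + 1) ≤ 2 ^ (2 * ℓ + 5) := by
  have h1 : ℓ + 3 ≤ 2 ^ (ℓ + 3) := (Nat.lt_two_pow_self).le
  calc (2 * ℓ + 6) * 2 ^ (ℓ + 1) = (ℓ + 3) * 2 ^ (ℓ + 2) := by ring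
    _ ≤ 2 ^ (ℓ + 3) * 2 ^ (ℓ + 2) := Nat.mul_le_mul_right _ h1
    _ = 2 ^ (2 * ℓ + 5) := by rw [← pow_add]; ring_nf

/-- **A good prime of controlled size.** For every threshold `X₀` and every finite set `bad` there
is a prime `p > X₀`, `p ∉ bad`, with `p ≤ 2^{2 log₂(X₀ + #bad + 2) + 6}`. -/
theorem exists_prime_gt_notMem_le (X₀ : ℕ) (bad : Finset ℕ) :
    ∃ p : ℕ, p.Prime ∧ X₀ < p ∧ p ∉ bad ∧ p ≤ 2 ^ (2 * Nat.log 2 (X₀ + bad.card + 2) + 6) := by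
  classical
  set n := X₀ + bad.card + 2 with hn
  set ℓ := Nat.log 2 n with hℓ
  set μ := 2 * ℓ + 6 with hμ
  have hμ3 : 3 ≤ μ := by omega
  -- `n ≤ π(2^μ)`
  have hnlt : n < 2 ^ (ℓ + 1) := Nat.lt_pow_succ_log_self one_lt_two n
  have hkey : μ * n ≤ μ * Nat.primeCounting (2 ^ μ) := by
    calc μ * n ≤ (2 * ℓ + 6) * 2 ^ (ℓ + 1) := Nat.mul_le_mul_left _ hnlt.le
      _ ≤ 2 ^ (2 * ℓ + 5) := aux_pow_bound ℓ
      _ = 2 ^ (μ - 1) := by rw [hμ]; congr 1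
      _ ≤ μ * Nat.primeCounting (2 ^ μ) := two_pow_le_mul_primeCounting hμ3
  have hπ : n ≤ Nat.primeCounting (2 ^ μ) := Nat.le_of_mul_le_mul_left hkey (by omega)
  -- counting
  set P := (Finset.range (2 ^ μ + 1)).filter Nat.Prime with hP
  have hPcard : P.card = Nat.primeCounting (2 ^ μ) := by
    rw [hP, Nat.primeCounting, Nat.primeCounting', Nat.count_eq_card_filter_range]
  set Bset := bad ∪ Finset.range (X₀ + 1) with hB
  have hBcard : Bset.card < P.card := by
    calc Bset.card ≤ bad.card + (Finset.range (X₀ + 1)).card := Finset.card_union_le _ _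
      _ = bad.card + (X₀ + 1) := by rw [Finset.card_range]
      _ < n := by omega
      _ ≤ P.card := by rw [hPcard]; exact hπ
  obtain ⟨p, hpP, hpB⟩ := Finset.exists_mem_notMem_of_card_lt_card hBcard
  rw [hP, Finset.mem_filter, Finset.mem_range] at hpP
  rw [hB, Finset.mem_union, Finset.mem_range, not_or] at hpB
  exact ⟨p, hpP.2, by omega, hpB.1, by omega⟩

end Summit.ValiantsHypothesis.ValiantsHypothesis.Theorems.LangWeilTransfer
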